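import Summits.CriticalPhenomena.CardyFormulaZ2.Theorems.CardyMagicRigidityLoopLimitZ2EqTSiteEndCrossingsQuad
import Literature.Topology.PlaneTopology.UniformLocalConnectedness

/-!
# The upper comparison domain of a conformal rectangle (stub `stub_mixedApproximants`, part 1)

Support file of the line `Sketch` for the crux `UniformMarginality` (stmt-CriticalPhenomena-5472,
route `CardySelfDualSegment`), first part of the stub `stub_mixedApproximants` (rectilinear
inner/outer approximants of a conformal rectangle with nested crude crossing events).

For a conformal rectangle `R = (Ω; P₀, P₁, P₂, P₃)`, a closeness budget `ε > 0` and a collar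
width `λ > 0` we build the **upper comparison domain** `U` (`exists_upperDomain`): a conformal
rectangle whose boundary loop and marks are `ε`-close to those of `R` IN THE PARAMETRISATION OF
`R`, which is pushed OUT of `Ω` across the arcs `1, 3` and pushed INTO `Ω` along the arcs `0, 2`,
with a room `r > 0`: every point of `closure Ω` at distance `≥ λ` from `arc₀ ∪ arc₂` lies in `U`, at
distance `> r` from `∂U`; the `r`-fattened arcs `1, 3` of `U` lie off `closure Ω`; the `r`-fattened
arcs `0, 2` of `U` lie within `λ` of the arcs `0, 2` of `R`; the `r`-fattened `U` misses `arc₀ ∪ arc₂`.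

Construction (Bollobás–Riordan, *Percolation* (2006), Ch. 7 p. 186, Fig. 14, as in
`exists_lowerQuad` of `CardyMagicRigidityLoopsToCrossingsStubComparisonGeometry.lean` with the
roles of the arc pairs exchanged): the boundary loop of `U` is the profile loop
`u ↦ T.tube (p u) u` (`ProfileCollar.lean`) of a two-plateau trapezoid profile, high plateau
`1 + h` strictly inside the parameter ranges of the arcs `1, 3`, low plateau `1 - h` along the
arcs `0, 2` and their corners. Since the cut-back arc `0` of `U` has a LONGER parameter range
than `arc₀(R)`, the loop is re-parametrised by the shift `u ↦ u - s` (absorbed by the uniform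
continuity of `∂R`) so that the marks of `U` are `(m₀, m₁ + 2s, m₂, m₃ + 2s)` in the
parametrisation of `R`. (Window reading of `1`-periodic functions: `siteEndCrossings_apply_window` of
`CardyMagicRigidityLoopLimitZ2EqTSiteEndCrossingsQuad.lean`.)
-/

noncomputable section

namespace Summit.CriticalPhenomena.CardyFormulaZ2.Cruxes.UniformMarginality.HeatFlow.MixedApprox

open Set Metric Filter Topology
open Literature.Probability.RandomPlanarGeometry
open Summit.CriticalPhenomena.CardyFormulaZ2.Cruxes.LoopLimitZ2EqT.HexSegment (siteEndCrossings_apply_window)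

/-- **Points of the closed domain in tube coordinates**: a point of `closure D` is the centre
`z₀` or an interior tube point `tube σ t` with `0 < σ ≤ 1` (polar form in the closed disc chart).
-/
theorem exists_eq_tube_of_mem_closure {D : JordanDomain} (T : D.TubeData) {z : ℂ}
    (hz : z ∈ closure D.carrier) : z = T.z₀ ∨ ∃ σ t : ℝ, 0 < σ ∧ σ ≤ 1 ∧ z = T.tube σ t := by
  obtain ⟨u, hu, rfl⟩ := T.Ci.bijOn.surjOn hz
  have hu1 : ‖u‖ ≤ 1 := mem_closedBall_zero_iff.1 hu
  rcases eq_or_ne u 0 with rfl | hu0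
  · exact Or.inl T.Ci_zero
  right
  have hn : 0 < ‖u‖ := norm_pos_iff.2 hu0
  set v : ℂ := ((‖u‖⁻¹ : ℝ) : ℂ) * u with hv
  have hv1 : ‖v‖ = 1 := by
    rw [hv, norm_mul, Complex.norm_real, Real.norm_eq_abs, abs_of_pos (inv_pos.2 hn),
      inv_mul_cancel₀ hn.ne']
  obtain ⟨t, ht⟩ : ∃ t, T.Ci.β t = v := by
    have hfr : T.Ci.Φ v ∈ frontier D.carrier := T.Ci.apply_mem_frontier hv1
    rw [← D.range_boundary] at hfr
    obtain ⟨t, ht⟩ := hfr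
    refine ⟨t, ?_⟩
    have h1 : T.Ci.Φ (T.Ci.β t) = T.Ci.Φ v := by rw [T.Ci.apply_β]; exact ht
    exact T.Ci.injOn (mem_closedBall_zero_iff.2 (T.Ci.norm_β t).le)
      (mem_closedBall_zero_iff.2 hv1.le) h1
  have hu' : u = ((‖u‖ : ℝ) : ℂ) * T.Ci.β t := by
    rw [ht, hv, ← mul_assoc, ← Complex.ofReal_mul, mul_inv_cancel₀ hn.ne', Complex.ofReal_one,
      one_mul]
  exact ⟨‖u‖, t, hn, hu1, by rw [T.tube_of_le_one hu1, ← hu']⟩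

set_option maxHeartbeats 800000 in
/-- **The upper comparison domain of a conformal rectangle** (see the module docstring): for
`ε, λ > 0` a conformal rectangle `U`, `ε`-close to `R` in boundary loop and marks (in the
parametrisation of `R`), with a room `r > 0` such that: deep points of `closure R` (at distance
`≥ λ` from the arcs `0, 2` of `R`) lie in `U` at distance `> r` from `∂U`; the `r`-fattened arcs
`1, 3` of `U` miss `closure R`; the `r`-fattened arcs `0, 2` of `U` are within `λ` of the arcs
`0, 2` of `R`; the `r`-fattened `U` misses the arcs `0, 2` of `R`.
[cite: BollobasRiordan2006, Ch. 7 Lemma 14 p. 184 and p. 186 (Fig. 14)] -/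
theorem exists_upperDomain : ∀ (R : ConformalRectangle) (ε lam : ℝ), 0 < ε → 0 < lam →
    ∃ (U : ConformalRectangle) (r : ℝ), 0 < r ∧
      (∀ u : ℝ, dist (U.boundary u) (R.boundary u) ≤ ε) ∧
      (∀ i : Fin 4, |U.mark i - R.mark i| ≤ ε) ∧
      (∀ z ∈ closure R.carrier, lam ≤ infDist z (R.arc 0) → lam ≤ infDist z (R.arc 2) →
        z ∈ U.carrier ∧ ∀ w ∈ frontier U.carrier, r < dist z w) ∧
      (∀ z ∈ cthickening r (U.arc 1), z ∉ closure R.carrier) ∧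
      (∀ z ∈ cthickening r (U.arc 3), z ∉ closure R.carrier) ∧
      (∀ z ∈ cthickening r (U.arc 0), infDist z (R.arc 0) < lam) ∧
      (∀ z ∈ cthickening r (U.arc 2), infDist z (R.arc 2) < lam) ∧
      (∀ z ∈ cthickening r U.carrier, z ∉ R.arc 0 ∪ R.arc 2) := by
  intro R ε lam hε hlam
  obtain ⟨h0, h1, h2, h3, h4⟩ := R.marks_chain
  obtain ⟨n0, -, n2, -⟩ := R.nextMarks_eq
  have hm3 : R.mark 3 < 1 := (R.mark_mem 3).2
  obtain ⟨T⟩ := R.toJordanDomain.nonempty_tubeData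
  -- the closeness scale `ν` and the parameter scale `τ`
  set ν : ℝ := min (ε / 2) (lam / 4) with hν
  have hν0 : 0 < ν := lt_min (by linarith) (by linarith)
  have hνε : ν ≤ ε / 2 := min_le_left _ _; have hνl : ν ≤ lam / 4 := min_le_right _ _
  obtain ⟨τ, hτ0, -, hτ⟩ := R.toJordanDomain.exists_forall_dist_boundary_lt hν0
  -- the parameter room `s`
  set s : ℝ := min (min τ (ε / 2)) (min ((R.mark 2 - R.mark 1) / 4) ((1 - R.mark 3) / 4)) with hs
  have hs0 : 0 < s := lt_min (lt_min hτ0 (by linarith)) (lt_min (by linarith) (by linarith))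
  have hsτ : s ≤ τ := by rw [hs]; exact (min_le_left _ _).trans (min_le_left _ _)
  have hsε : s ≤ ε / 2 := by rw [hs]; exact (min_le_left _ _).trans (min_le_right _ _)
  have hs12 : s ≤ (R.mark 2 - R.mark 1) / 4 := by rw [hs]; exact (min_le_right _ _).trans (min_le_left _ _)
  have hs3 : s ≤ (1 - R.mark 3) / 4 := by rw [hs]; exact (min_le_right _ _).trans (min_le_right _ _)
  -- the corners, as points of the arcs `0, 2`
  have hb0 : R.boundary (R.mark 0) ∈ R.arc 0 := ⟨R.mark 0, ⟨le_rfl, by rw [n0]; exact h1.le⟩, rfl⟩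
  have hb1 : R.boundary (R.mark 1) ∈ R.arc 0 := ⟨R.mark 1, ⟨h1.le, by rw [n0]⟩, rfl⟩
  have hb2 : R.boundary (R.mark 2) ∈ R.arc 2 := ⟨R.mark 2, ⟨le_rfl, by rw [n2]; exact h3.le⟩, rfl⟩
  have hb3 : R.boundary (R.mark 3) ∈ R.arc 2 := ⟨R.mark 3, ⟨h3.le, by rw [n2]⟩, rfl⟩
  -- separation of the inner parts of the arcs `1, 3` from the arcs `0, 2`
  obtain ⟨d₀, hd₀, hsep⟩ : ∃ d₀ : ℝ, 0 < d₀ ∧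
      ∀ v ∈ Icc (R.mark 1 + s / 8) (R.mark 2 - s / 8) ∪ Icc (R.mark 3 + s / 8) (R.mark 0 + 1 - s / 8),
        ∀ b ∈ R.arc 0 ∪ R.arc 2, d₀ ≤ dist (R.boundary v) b := by
    obtain ⟨R', -, hR'b, hR'm, -, ha1, -, ha3⟩ := R.exists_shiftMarks
    obtain ⟨d₀, hd₀, h⟩ := R'.exists_sep_arcs (κ := s / 8) (by linarith)
    refine ⟨d₀, hd₀, fun v hv b hb => ?_⟩
    have hb' : b ∈ R'.arc 1 ∪ R'.arc 3 := by rw [ha1, ha3]; exact Or.symm hb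
    have e0 : R'.mark 0 = 0 := hR'm 0; have e1 : R'.mark 1 = R.mark 2 - R.mark 1 := hR'm 1
    have e2 : R'.mark 2 = R.mark 3 - R.mark 1 := hR'm 2; have e3 : R'.mark 3 = R.mark 0 + 1 - R.mark 1 := hR'm 3
    have key := h (v - R.mark 1) ?_ b hb'
    · rwa [hR'b, sub_add_cancel] at key
    · rw [e0, e1, e2, e3]; rcases hv with ⟨ha, hb⟩ | ⟨ha, hb⟩
      · exact Or.inl ⟨by linarith, by linarith⟩
      · exact Or.inr ⟨by linarith, by linarith⟩
  -- the tube tolerance `tol` and the depth `h`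
  have hρ₀ := R.toJordanDomain.infDist_frontier_pos T.hz₀
  set tol : ℝ := min (min ν (infDist T.z₀ (frontier R.carrier))) (d₀ / 4) with htol_def
  have htol0 : 0 < tol := lt_min (lt_min hν0 hρ₀) (by linarith)
  have htolν : tol ≤ ν := (min_le_left _ _).trans (min_le_left _ _)
  have htolz : tol ≤ infDist T.z₀ (frontier R.carrier) := (min_le_left _ _).trans (min_le_right _ _)
  have htold : tol ≤ d₀ / 4 := min_le_right _ _
  obtain ⟨h, hh, hh1, htol⟩ := T.exists_dist_tube_lt htol0
  obtain ⟨mi, hmi, hdeep⟩ := T.exists_le_infDist_tube_inner (h := h / 2) (by linarith) (by linarith)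
  obtain ⟨mo, hmo, hout⟩ := T.exists_le_infDist_tube_outer (h := h) hh hh1
  have hout1 : ∀ t, mo ≤ infDist (T.tube (1 + h) t) (closure R.carrier) := fun t => hout _ t le_rfl (by linarith)
  -- the profile: high on the inner parts of the arcs `1, 3`, low along the arcs `0, 2`
  obtain ⟨p, hpc, hper, hband, hplat, hloc⟩ := exists_trapezoid_profile (a₀ := R.mark 1)
    (a₁ := R.mark 2) (a₂ := R.mark 3) (a₃ := R.mark 0 + 1) (s := s) (h := h) (θ := h)
    (by linarith) h3.le (by linarith) (by linarith) hs0 hh hh le_rfl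
  have hp0 : ∀ u, 0 < p u := fun u => by linarith [(hband u).1]
  have hp2 : ∀ u, p u < 2 := fun u => by linarith [(hband u).2]
  have htolp : ∀ u, dist (T.tube (p u) u) (R.boundary u) < tol := fun u => htol _ _ (hband u).1 (hband u).2
  -- the room `r`
  set r : ℝ := min (min (mo / 4) (mi / 4)) (min (d₀ / 8) (lam / 8)) with hr_def
  have hr : 0 < r := by positivity
  have hrmo : r ≤ mo / 4 := by rw [hr_def]; exact (min_le_left _ _).trans (min_le_left _ _)
  have hrmi : r ≤ mi / 4 := by rw [hr_def]; exact (min_le_left _ _).trans (min_le_right _ _)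
  have hrd : r ≤ d₀ / 8 := by rw [hr_def]; exact (min_le_right _ _).trans (min_le_left _ _)
  have hrl : r ≤ lam / 8 := by rw [hr_def]; exact (min_le_right _ _).trans (min_le_right _ _)
  -- the profile domain and the re-parametrised conformal rectangle
  let L : JordanDomain := JordanDomain.ofLoop (T.continuous_profileLoop hpc hp0 hp2)
    (T.periodic_profileLoop hper) (T.injOn_profileLoop hp0 hp2)
  have hLf : frontier L.carrier = range fun u => T.tube (p u) u := JordanDomain.frontier_ofLoop_carrier _ _ _
  let U : ConformalRectangle :=
    { carrier := L.carrier
      boundary := fun u => T.tube (p (u - s)) (u - s)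
      isOpen := L.isOpen, isBounded := L.isBounded, isConnected := L.isConnected
      continuous_boundary := L.continuous_boundary.comp (continuous_id.sub continuous_const)
      periodic_boundary := fun u => by
        show T.tube (p (u + 1 - s)) (u + 1 - s) = T.tube (p (u - s)) (u - s)
        rw [show u + 1 - s = u - s + 1 by ring]
        exact T.periodic_profileLoop hper (u - s)
      injOn_boundary := fun a ha b hb hab => sub_left_inj.1 (L.injOn_boundary_Ico (-s)
        (show a - s ∈ Ico (-s) (-s + 1) from ⟨by linarith [ha.1], by linarith [ha.2]⟩)
        (show b - s ∈ Ico (-s) (-s + 1) from ⟨by linarith [hb.1], by linarith [hb.2]⟩) hab)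
      range_boundary := by
        rw [← L.range_boundary]
        ext z
        refine ⟨fun ⟨u, hu⟩ => ⟨u - s, hu⟩, fun ⟨u, hu⟩ => ⟨u + s, ?_⟩⟩
        show T.tube (p (u + s - s)) (u + s - s) = z
        rw [add_sub_cancel_right]; exact hu
      mark := ![R.mark 0, R.mark 1 + 2 * s, R.mark 2, R.mark 3 + 2 * s]
      strictMono_mark := Fin.strictMono_iff_lt_succ.2 fun k => by
        fin_cases k
        · show R.mark 0 < R.mark 1 + 2 * s; linarith
        · show R.mark 1 + 2 * s < R.mark 2; linarith
        · show R.mark 2 < R.mark 3 + 2 * s; linarith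
      mark_mem := fun k => by
        fin_cases k
        · show R.mark 0 ∈ Ico 0 1; exact ⟨h0, by linarith⟩
        · show R.mark 1 + 2 * s ∈ Ico 0 1; exact ⟨by linarith, by linarith⟩
        · show R.mark 2 ∈ Ico 0 1; exact ⟨by linarith, by linarith⟩
        · show R.mark 3 + 2 * s ∈ Ico 0 1; exact ⟨by linarith, by linarith⟩ }
  have hUf : frontier U.carrier = range fun u => T.tube (p u) u := hLf
  obtain ⟨nU0, nU1, nU2, nU3⟩ := U.nextMarks_eq
  -- the centre is inside
  have hz₀ : T.z₀ ∈ U.carrier :=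
    T.z₀_mem_of_frontier_eq hpc hper hp0 hp2 U.toJordanDomain hUf fun u => (htolp u).trans_le htolz
  -- the high set of parameters and the reading of the other parameters of the window
  set H : Set ℝ := Icc (R.mark 1 + s / 2) (R.mark 2 - s / 2) ∪
    Icc (R.mark 3 + s / 2) (R.mark 0 + 1 - s / 2) with hH
  have hnear : ∀ t, R.mark 1 ≤ t → t < R.mark 1 + 1 → t ∉ H →
      infDist (R.boundary t) (R.arc 0) < ν ∨ infDist (R.boundary t) (R.arc 2) < ν := by
    intro t ht1 ht2 hnot
    simp only [hH, mem_union, mem_Icc, not_or, not_and, not_le] at hnot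
    obtain ⟨hA, hB⟩ := hnot
    have key : ∀ {v : ℝ} {A : Set ℂ}, |t - v| ≤ τ → R.boundary v ∈ A →
        infDist (R.boundary t) A < ν :=
      fun htv hv => (infDist_le_dist_of_mem hv).trans_lt (hτ _ _ htv)
    by_cases c1 : t < R.mark 1 + s / 2
    · exact Or.inl (key (v := R.mark 1) (abs_le.2 ⟨by linarith, by linarith⟩) hb1)
    push Not at c1
    have c2 := hA c1
    by_cases c3 : t < R.mark 3 + s / 2
    · right
      rcases le_or_gt t (R.mark 2) with c4 | c4
      · exact key (v := R.mark 2) (abs_le.2 ⟨by linarith, by linarith⟩) hb2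
      rcases le_or_gt t (R.mark 3) with c5 | c5
      · rw [infDist_zero_of_mem (show R.boundary t ∈ R.arc 2 from ⟨t, ⟨c4.le, by rw [n2]; exact c5⟩, rfl⟩)]
        exact hν0
      · exact key (v := R.mark 3) (abs_le.2 ⟨by linarith, by linarith⟩) hb3
    push Not at c3
    have c6 := hB c3
    left
    rcases le_or_gt (R.mark 0 + 1) t with c7 | c7
    · have hper1 : R.boundary t = R.boundary (t - 1) := by
        rw [← R.periodic_boundary (t - 1), sub_add_cancel]
      rw [hper1, infDist_zero_of_mem (show R.boundary (t - 1) ∈ R.arc 0 from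
        ⟨t - 1, ⟨by linarith, by rw [n0]; linarith⟩, rfl⟩)]
      exact hν0
    · have hv : R.boundary (R.mark 0 + 1) ∈ R.arc 0 := by rw [R.periodic_boundary]; exact hb0
      exact key (v := R.mark 0 + 1) (abs_le.2 ⟨by linarith, by linarith⟩) hv
  have hwin : ∀ t : ℝ, ∃ t' : ℝ, R.mark 1 ≤ t' ∧ t' < R.mark 1 + 1 ∧ R.boundary t' = R.boundary t ∧
      p t' = p t ∧ ∀ σ, T.tube σ t' = T.tube σ t := fun t =>
    ⟨R.mark 1 + Int.fract (t - R.mark 1), by linarith [Int.fract_nonneg (t - R.mark 1)],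
      by linarith [Int.fract_lt_one (t - R.mark 1)],
      siteEndCrossings_apply_window R.periodic_boundary _ _, siteEndCrossings_apply_window hper _ _,
      fun σ => siteEndCrossings_apply_window (T.periodic_tube σ) _ _⟩
  -- a point `tol`-close to a non-high boundary point is `λ/2`-close to the arcs `0, 2`
  have hsub : ∀ (x : ℂ) (t : ℝ), R.mark 1 ≤ t → t < R.mark 1 + 1 → t ∉ H →
      dist x (R.boundary t) < tol → infDist x (R.arc 0) < lam / 2 ∨ infDist x (R.arc 2) < lam / 2 := by
    intro x t ht1 ht2 hnot hxt
    rcases hnear t ht1 ht2 hnot with hn | hn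
    · left
      have := infDist_le_infDist_add_dist (s := R.arc 0) (x := x) (y := R.boundary t)
      linarith
    · right
      have := infDist_le_infDist_add_dist (s := R.arc 2) (x := x) (y := R.boundary t)
      linarith
  -- (UA) deep points of `closure R` are in `U`, with room `r`
  have hUA : ∀ z ∈ closure R.carrier, lam ≤ infDist z (R.arc 0) → lam ≤ infDist z (R.arc 2) →
      z ∈ U.carrier ∧ ∀ w ∈ frontier U.carrier, r < dist z w := by
    intro z hz hl0 hl2
    refine ⟨?_, fun w hw => ?_⟩
    · rcases exists_eq_tube_of_mem_closure T hz with rfl | ⟨σ, t, hσ0, hσ1, rfl⟩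
      · exact hz₀
      obtain ⟨t', ht1, ht2, -, -, htt⟩ := hwin t
      rw [← htt σ]
      by_cases hhigh : t' ∈ H
      · exact T.tube_mem_of_frontier_eq hper hp0 hp2 U.toJordanDomain hUf hz₀ hσ0.le
          (by rw [hplat t' hhigh]; linarith)
      by_cases hσh : σ < 1 - h
      · exact T.tube_mem_of_frontier_eq hper hp0 hp2 U.toJordanDomain hUf hz₀ hσ0.le
          (hσh.trans_le (hband t').1)
      exfalso
      push Not at hσh
      have hd : dist (T.tube σ t') (R.boundary t') < tol := htol σ t' hσh (by linarith)
      rcases hsub _ t' ht1 ht2 hhigh hd with hlt | hlt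
      · rw [htt σ] at hlt; linarith
      · rw [htt σ] at hlt; linarith
    · rw [hUf] at hw
      obtain ⟨t, rfl⟩ := hw
      obtain ⟨t', ht1, ht2, -, hpt, htt⟩ := hwin t
      show r < dist z (T.tube (p t) t)
      rw [← hpt, ← htt (p t')]
      by_cases hhigh : t' ∈ H
      · rw [hplat t' hhigh]
        have := (hout1 t').trans (infDist_le_dist_of_mem hz)
        rw [dist_comm] at this
        linarith
      · rcases hsub _ t' ht1 ht2 hhigh (htolp t') with hlt | hlt
        · have := infDist_le_infDist_add_dist (s := R.arc 0) (x := z) (y := T.tube (p t') t')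
          linarith
        · have := infDist_le_infDist_add_dist (s := R.arc 2) (x := z) (y := T.tube (p t') t')
          linarith
  -- (UB) the fattened arcs `1, 3` of `U` are off `closure R`
  have hcap : ∀ (v : ℝ) (z : ℂ), v ∈ H → dist z (T.tube (p v) v) ≤ 2 * r → z ∉ closure R.carrier := by
    intro v z hv hzx hzR
    have h1 := hout1 v
    rw [← hplat v hv] at h1
    have h2 := h1.trans (infDist_le_dist_of_mem hzR)
    rw [dist_comm] at hzx
    linarith
  have hUB1 : ∀ z ∈ cthickening r (U.arc 1), z ∉ closure R.carrier := by
    intro z hz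
    obtain ⟨x, hx, hzx⟩ := exists_dist_le_two_mul_of_mem_cthickening hr hz
    obtain ⟨u, hu, rfl⟩ := hx
    rw [nU1] at hu
    change u ∈ Icc (R.mark 1 + 2 * s) (R.mark 2) at hu
    exact hcap (u - s) z (Or.inl ⟨by linarith [hu.1], by linarith [hu.2]⟩) hzx
  have hUB3 : ∀ z ∈ cthickening r (U.arc 3), z ∉ closure R.carrier := by
    intro z hz
    obtain ⟨x, hx, hzx⟩ := exists_dist_le_two_mul_of_mem_cthickening hr hz
    obtain ⟨u, hu, rfl⟩ := hx
    rw [nU3] at hu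
    change u ∈ Icc (R.mark 3 + 2 * s) (R.mark 0 + 1) at hu
    exact hcap (u - s) z (Or.inr ⟨by linarith [hu.1], by linarith [hu.2]⟩) hzx
  -- (UC) the fattened arcs `0, 2` of `U` are near the arcs `0, 2` of `R`
  have hnearU : ∀ (v : ℝ) (z : ℂ) (A : Set ℂ), dist z (T.tube (p v) v) ≤ 2 * r →
      infDist (R.boundary v) A < ν → infDist z A < lam := by
    intro v z A hzx hv
    have t1 := infDist_le_infDist_add_dist (s := A) (x := z) (y := T.tube (p v) v)
    have t2 := infDist_le_infDist_add_dist (s := A) (x := T.tube (p v) v) (y := R.boundary v)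
    have t3 := htolp v
    linarith
  have hUC0 : ∀ z ∈ cthickening r (U.arc 0), infDist z (R.arc 0) < lam := by
    intro z hz
    obtain ⟨x, hx, hzx⟩ := exists_dist_le_two_mul_of_mem_cthickening hr hz
    obtain ⟨u, hu, rfl⟩ := hx
    rw [nU0] at hu
    change u ∈ Icc (R.mark 0) (R.mark 1 + 2 * s) at hu
    refine hnearU (u - s) z (R.arc 0) hzx ?_
    rcases lt_or_ge (u - s) (R.mark 0) with c | c
    · exact (infDist_le_dist_of_mem hb0).trans_lt
        (hτ (u - s) (R.mark 0) (abs_le.2 ⟨by linarith [hu.1], by linarith⟩))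
    rcases le_or_gt (u - s) (R.mark 1) with c' | c'
    · rw [infDist_zero_of_mem (show R.boundary (u - s) ∈ R.arc 0 from
        ⟨u - s, ⟨c, by rw [n0]; exact c'⟩, rfl⟩)]
      exact hν0
    · exact (infDist_le_dist_of_mem hb1).trans_lt
        (hτ (u - s) (R.mark 1) (abs_le.2 ⟨by linarith, by linarith [hu.2]⟩))
  have hUC2 : ∀ z ∈ cthickening r (U.arc 2), infDist z (R.arc 2) < lam := by
    intro z hz
    obtain ⟨x, hx, hzx⟩ := exists_dist_le_two_mul_of_mem_cthickening hr hz
    obtain ⟨u, hu, rfl⟩ := hx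
    rw [nU2] at hu
    change u ∈ Icc (R.mark 2) (R.mark 3 + 2 * s) at hu
    refine hnearU (u - s) z (R.arc 2) hzx ?_
    rcases lt_or_ge (u - s) (R.mark 2) with c | c
    · exact (infDist_le_dist_of_mem hb2).trans_lt
        (hτ (u - s) (R.mark 2) (abs_le.2 ⟨by linarith [hu.1], by linarith⟩))
    rcases le_or_gt (u - s) (R.mark 3) with c' | c'
    · rw [infDist_zero_of_mem (show R.boundary (u - s) ∈ R.arc 2 from
        ⟨u - s, ⟨c, by rw [n2]; exact c'⟩, rfl⟩)]
      exact hν0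
    · exact (infDist_le_dist_of_mem hb3).trans_lt
        (hτ (u - s) (R.mark 3) (abs_le.2 ⟨by linarith, by linarith [hu.2]⟩))
  -- (UD) the fattened `U` is off the arcs `0, 2` of `R`
  have hUD : ∀ z ∈ cthickening r U.carrier, z ∉ R.arc 0 ∪ R.arc 2 := by
    intro z hz hzB
    obtain ⟨x, hx, hzx⟩ := exists_dist_le_two_mul_of_mem_cthickening hr hz
    have hfar : ∀ b ∈ R.arc 0 ∪ R.arc 2, min mi (d₀ / 2) ≤ dist x b := by
      intro b hb
      have hbf : b ∈ frontier R.carrier :=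
        hb.elim (fun hb => R.arc_subset_frontier 0 hb) (fun hb => R.arc_subset_frontier 2 hb)
      obtain ⟨σ, t, hσ0, hσp, hxe⟩ : ∃ σ t : ℝ, 0 ≤ σ ∧ σ < p t ∧ x = T.tube σ t := by
        by_cases hxR : x ∈ R.carrier
        · obtain ⟨σ, t, hσ0, -, hσp, hxe⟩ :=
            T.exists_eq_tube_of_mem_of_mem'' hper hp0 hp2 U.toJordanDomain hUf hx hxR
          exact ⟨σ, t, hσ0, hσp, hxe⟩
        · obtain ⟨σ, t, hσ1, hσp, hxe⟩ :=
            T.exists_eq_tube_of_mem_of_not_mem' hper hp0 hp2 U.toJordanDomain hUf hx hxR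
          exact ⟨σ, t, by linarith, hσp, hxe⟩
      rw [hxe]
      rcases le_or_gt σ (1 - h / 2) with hσd | hσs
      · exact (min_le_left _ _).trans
          ((hdeep σ t (abs_le.2 ⟨by linarith, hσd⟩)).trans (infDist_le_dist_of_mem hbf))
      · have hK : d₀ ≤ dist (R.boundary t) b := by
          rw [← siteEndCrossings_apply_window R.periodic_boundary (R.mark 1) t]
          refine hsep _ ?_ b hb
          rcases hloc t (hσs.trans hσp) with ⟨ha, hb'⟩ | ⟨ha, hb'⟩
          · exact Or.inl ⟨ha.le, hb'.le⟩
          · exact Or.inr ⟨ha.le, hb'.le⟩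
        have hd : dist (T.tube σ t) (R.boundary t) < tol :=
          htol σ t (by linarith) (by linarith [(hband t).2])
        have := dist_triangle (R.boundary t) (T.tube σ t) b
        rw [dist_comm (R.boundary t) (T.tube σ t)] at this
        exact (min_le_right _ _).trans (by linarith)
    have := hfar z hzB
    rw [dist_comm] at hzx
    have hr2 : 2 * r < min mi (d₀ / 2) := lt_min (by linarith) (by linarith)
    linarith
  refine ⟨U, r, hr, fun u => ?_, fun i => ?_, hUA, hUB1, hUB3, hUC0, hUC2, hUD⟩
  · -- closeness of the boundary loops, in the parametrisation of `R`
    show dist (T.tube (p (u - s)) (u - s)) (R.boundary u) ≤ ε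
    have a := htolp (u - s)
    have b := hτ (u - s) u (abs_le.2 ⟨by linarith, by linarith⟩)
    linarith [dist_triangle (T.tube (p (u - s)) (u - s)) (R.boundary (u - s)) (R.boundary u)]
  · -- closeness of the marks
    fin_cases i
    · show |R.mark 0 - R.mark 0| ≤ ε; rw [sub_self, abs_zero]; exact hε.le
    · show |R.mark 1 + 2 * s - R.mark 1| ≤ ε; rw [add_sub_cancel_left, abs_of_pos (by linarith)]; linarith
    · show |R.mark 2 - R.mark 2| ≤ ε; rw [sub_self, abs_zero]; exact hε.le
    · show |R.mark 3 + 2 * s - R.mark 3| ≤ ε; rw [add_sub_cancel_left, abs_of_pos (by linarith)]; linarith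

end Summit.CriticalPhenomena.CardyFormulaZ2.Cruxes.UniformMarginality.HeatFlow.MixedApprox

end
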